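import Summits.BirchSwinnertonDyer.BirchSwinnertonDyer.Theorems.ManinLocalTwoThreeAtkinLehnerEtaFiftySix
import Literature.NumberTheory.ModularForms.DedekindSumCongruences
import HarnessLib

/-!
# Level 45: the Atkin–Lehner involution `W₅` as an `η`-FACTOR PERMUTATION at the cusp `1/9`, and the `W₅`-invariance of the
# coordinates `T = η₁η₅/(η₉η₄₅)` (`= x − 2` on `45a1`) and `S = η₃²η₁₅²/(η₉²η₄₅²)` (`2S − 3T = 2y + x`)

Cell `bsd-f2-manin`, route `ManinLocalTwoThree`, crux C3 `ManinPrimeToThreeAtNine` (stmt-BirchSwinnertonDyer-22968: `3² ∣ 45`), prover seat p2 gen 28;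
`--supports` (helper).  The level-`56` device (`…AtkinLehnerEtaFiftySix`, `W₇ = A₀β`) at level `45 = 9·5`: `W₅ = (5 1; 45 10) = A₀·β` with
`A₀ = (1 0; 9 1) ∈ SL₂(ℤ)` (`A₀∞ = 1/9`, the second cusp of the fibre of `x` on `45a1`) and `β : τ ↦ 5τ + 1`; for every `δ ∣ 45`, `δ = δ₁δ₂`
(`δ₁ ∣ 9`, `δ₂ ∣ 5`), the point `δ·A₀σ` is `M_δ(δ*τ)` with `τ = (σ − 1)/5`, `δ* = 5δ₁/δ₂` and `M_δ = (δ₂, δ₁; 9/δ₁, 10/δ₂) ∈ SL₂(ℤ)`, so Dedekind's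
functional equation ALONE gives `η(δ·A₀σ) = e^{πi(Φ(M_δ) − 3)/12} √((9σ+1)/δ₂) η(δ*τ)`, `Φ − 3 ∈ {−8, 0, 8}` at `δ = 1, 3, 9` (`s(10, c) = s(1, c)`)
and `∈ {−4, 0, 4}` at `δ = 5, 15, 45` (`s(2, c) = (c−1)(c−5)/(24c)`).  Consequences: `T(A₀σ) = T(τ)`, `S(A₀σ) = S(τ)` — the `q`-expansions of the
weight-`0` coordinates at the cusp `1/9` (width `5`) are those at `∞`.  Nothing here proves C3, Manin's conjecture or BSD.
[cite: AtkinLehner1970, Lemma 7] [cite: Apostol1990, Thm. 3.4, §3.7] [cite: RademacherGrosswald1972, Ch. 4 A, eq. (60)]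
-/

set_option autoImplicit false
-- lint-debt: the directory name repeats the summit name (sibling precedent `ManinLocalTwoThreeAtkinLehnerEtaFiftySix.lean`)
set_option linter.dupNamespace false

noncomputable section

open Complex Filter Topology Set Asymptotics
open UpperHalfPlane hiding I
open scoped Real Topology Manifold MatrixGroups ModularForm
open ModularForm CongruenceSubgroup
open Literature.NumberTheory.ModularForms
open Literature.NumberTheory.EllipticCurves Literature.NumberTheory.EllipticCurves.ModularForms

namespace Summit.BirchSwinnertonDyer.BirchSwinnertonDyer.Theorems.ManinLocalTwoThree.AtkinLehnerEtaFortyFive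

open AtkinLehnerEtaFiftySix (cexp_rademacher_eq_zpow)

/-! ## §1 The two Rademacher `Φ` values -/

/-- `Φ(1, b; c, 10) = (11 − (c−1)(c−2))/c` for `c ≥ 1` with `10 ≡ 1 (mod c)` (`s(10, c) = s(1, c) = (c−1)(c−2)/(12c)`).
[cite: RademacherGrosswald1972, Ch. 4 A, eq. (59)] -/
theorem rademacherPhi_one_ten (b : ℤ) (c : ℕ) (hc : 0 < c) (h10 : (10 : ℤ) % c = 1 % c) :
    rademacherPhi 1 b c 10 = (11 - ((c : ℚ) - 1) * ((c : ℚ) - 2)) / c := by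
  have hc0 : (c : ℤ) ≠ 0 := by exact_mod_cast hc.ne'
  have hcq : (c : ℚ) ≠ 0 := by exact_mod_cast hc.ne'
  rw [rademacherPhi_of_c_ne_zero hc0, Int.sign_natCast_of_ne_zero hc.ne', Int.natAbs_natCast,
    dedekindSum_congr_of_emod_eq h10, EtaQuotientLowerUnipotent.dedekindSum_one c hc]
  push_cast
  field_simp

/-- `Φ(5, b; c, 2) = (14 − (c−1)(c−5))/(2c)` for odd `c` (`s(2, c) = (c−1)(c−5)/(24c)`). [cite: Apostol1990, §3.7] -/
theorem rademacherPhi_five_two (b : ℤ) (c : ℕ) (hodd : Odd c) :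
    rademacherPhi 5 b c 2 = (14 - ((c : ℚ) - 1) * ((c : ℚ) - 5)) / (2 * c) := by
  have hc : 0 < c := hodd.pos
  have hc0 : (c : ℤ) ≠ 0 := by exact_mod_cast hc.ne'
  have hcq : (c : ℚ) ≠ 0 := by exact_mod_cast hc.ne'
  rw [rademacherPhi_of_c_ne_zero hc0, Int.sign_natCast_of_ne_zero hc.ne', Int.natAbs_natCast,
    show ((2 : ℤ) : ℤ) = ((2 : ℕ) : ℤ) from rfl]
  rw [show dedekindSum ((2 : ℕ) : ℤ) c = dedekindSum 2 c from rfl, dedekindSum_two_left hodd]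
  push_cast
  field_simp
  ring

/-! ## §2 `η(δ·A₀σ)` in terms of `η(δ*·τ)`, `τ = (σ − 1)/5` -/

/-- `9σ + 1 ≠ 0` on `ℍ`. [folklore] -/
theorem nine_mul_add_one_ne_zero (σ : ℍ) : (9 : ℂ) * σ + 1 ≠ 0 := by
  intro h
  have := congrArg Complex.im h
  simp at this
  exact absurd this σ.im_pos.ne'

/-- **The factors with `δ ∣ 9`**: for `A₀ = (1 0; 9 1)`, `δ ∣ 9`, `δ' = 5δ` and `τ = (σ − 1)/5`,
`η(δ·A₀σ) = e^{πi(Φ(M) − 3)/12} √(9σ+1) η(δ'τ)` with `M = (1, δ; 9/δ, 10) ∈ SL₂(ℤ)` (`δ·A₀σ = M(δ'τ)`; Dedekind's functional equation).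
[cite: Apostol1990, Thm. 3.4] [cite: AtkinLehner1970, Lemma 7] -/
theorem eta_natMul_A0_smul (A : SL(2, ℤ)) (h00 : A 0 0 = 1) (h01 : A 0 1 = 0) (h10 : A 1 0 = 9) (h11 : A 1 1 = 1)
    (δ : ℕ) (hδ : δ ∣ 9) (δ' : ℕ) (hδ' : δ' = 5 * δ) (σ : ℍ) :
    η ((δ : ℂ) * ((A • σ : ℍ) : ℂ))
      = cexp (π * I * (((rademacherPhi 1 (δ : ℤ) ((9 / δ : ℕ) : ℤ) 10 : ℚ) : ℂ) - 3) / 12)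
        * Complex.sqrt ((9 : ℂ) * σ + 1) * η ((δ' : ℂ) * ((affPt 1 (-1) 5 one_pos (by norm_num) σ : ℍ) : ℂ)) := by
  obtain ⟨e, he⟩ := hδ
  have hδpos : 0 < δ := Nat.pos_of_ne_zero (by rintro rfl; simp at he)
  have hepos : 0 < e := Nat.pos_of_ne_zero (by rintro rfl; simp at he)
  have h9e : 9 / δ = e := by rw [he, Nat.mul_div_cancel_left e hδpos]
  have hδe : (δ : ℤ) * e = 9 := by exact_mod_cast he.symm
  let M : SL(2, ℤ) := ⟨!![1, (δ : ℤ); (e : ℤ), 10], by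
    rw [Matrix.det_fin_two_of]; linear_combination (-1 : ℤ) * hδe⟩
  have hM00 : M 0 0 = 1 := rfl
  have hM01 : M 0 1 = (δ : ℤ) := rfl
  have hM10 : M 1 0 = (e : ℤ) := rfl
  have hM11 : M 1 1 = 10 := rfl
  have hδ'pos : 0 < δ' := by rw [hδ']; positivity
  set τ : ℍ := affPt 1 (-1) 5 one_pos (by norm_num) σ with hτ
  have hτc : (τ : ℂ) = ((σ : ℂ) - 1) / 5 := by rw [hτ, coe_affPt]; push_cast; ring
  have hj := nine_mul_add_one_ne_zero σ
  have hed : (e : ℂ) * δ = 9 := by exact_mod_cast (by rw [mul_comm]; exact he.symm : e * δ = 9)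
  have hden : ((M 1 0 : ℤ) : ℂ) * ((natMulPt δ' hδ'pos τ : ℍ) : ℂ) + (M 1 1 : ℤ) = (9 : ℂ) * σ + 1 := by
    rw [hM10, hM11, coe_natMulPt, hτc, hδ']
    push_cast
    field_simp
    linear_combination ((σ : ℂ) - 1) * hed
  have hpt : (δ : ℂ) * ((A • σ : ℍ) : ℂ) = ((M • natMulPt δ' hδ'pos τ : ℍ) : ℂ) := by
    rw [coe_SL2_smul, coe_SL2_smul, h00, h01, h10, h11, hM00, hM01, hM10, hM11, coe_natMulPt, hτc, hδ']
    push_cast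
    have hden' : (e : ℂ) * (5 * (δ : ℂ) * (((σ : ℂ) - 1) / 5)) + 10 = 9 * (σ : ℂ) + 1 := by
      field_simp
      linear_combination ((σ : ℂ) - 1) * hed
    rw [hden']
    field_simp
    ring
  rw [hpt, eta_SL2_smul_rademacherPhi M (by rw [hM10]; exact_mod_cast hepos) (natMulPt δ' hδ'pos τ), hden,
    rademacherPhiSL_apply, hM00, hM01, hM10, hM11, coe_natMulPt, h9e]

/-- **The factors with `5 ∣ δ`**: for `A₀ = (1 0; 9 1)`, `δ ∣ 9`, `δ' = 5δ` and `τ = (σ − 1)/5`,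
`η(δ'·A₀σ) = e^{πi(Φ(M) − 3)/12} √((9σ+1)/5) η(δτ)` with `M = (5, δ; 9/δ, 2) ∈ SL₂(ℤ)` (`δ'·A₀σ = M(δτ)`).
[cite: Apostol1990, Thm. 3.4] [cite: AtkinLehner1970, Lemma 7] -/
theorem eta_natMul_A0_smul' (A : SL(2, ℤ)) (h00 : A 0 0 = 1) (h01 : A 0 1 = 0) (h10 : A 1 0 = 9) (h11 : A 1 1 = 1)
    (δ : ℕ) (hδ : δ ∣ 9) (δ' : ℕ) (hδ' : δ' = 5 * δ) (σ : ℍ) :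
    η ((δ' : ℂ) * ((A • σ : ℍ) : ℂ))
      = cexp (π * I * (((rademacherPhi 5 (δ : ℤ) ((9 / δ : ℕ) : ℤ) 2 : ℚ) : ℂ) - 3) / 12)
        * Complex.sqrt (((9 : ℂ) * σ + 1) / 5) * η ((δ : ℂ) * ((affPt 1 (-1) 5 one_pos (by norm_num) σ : ℍ) : ℂ)) := by
  obtain ⟨e, he⟩ := hδ
  have hδpos : 0 < δ := Nat.pos_of_ne_zero (by rintro rfl; simp at he)
  have hepos : 0 < e := Nat.pos_of_ne_zero (by rintro rfl; simp at he)
  have h9e : 9 / δ = e := by rw [he, Nat.mul_div_cancel_left e hδpos]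
  have hδe : (δ : ℤ) * e = 9 := by exact_mod_cast he.symm
  let M : SL(2, ℤ) := ⟨!![5, (δ : ℤ); (e : ℤ), 2], by
    rw [Matrix.det_fin_two_of]; linear_combination (-1 : ℤ) * hδe⟩
  have hM00 : M 0 0 = 5 := rfl
  have hM01 : M 0 1 = (δ : ℤ) := rfl
  have hM10 : M 1 0 = (e : ℤ) := rfl
  have hM11 : M 1 1 = 2 := rfl
  set τ : ℍ := affPt 1 (-1) 5 one_pos (by norm_num) σ with hτ
  have hτc : (τ : ℂ) = ((σ : ℂ) - 1) / 5 := by rw [hτ, coe_affPt]; push_cast; ring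
  have hj := nine_mul_add_one_ne_zero σ
  have hed : (e : ℂ) * δ = 9 := by exact_mod_cast (by rw [mul_comm]; exact he.symm : e * δ = 9)
  have hden : ((M 1 0 : ℤ) : ℂ) * ((natMulPt δ hδpos τ : ℍ) : ℂ) + (M 1 1 : ℤ) = ((9 : ℂ) * σ + 1) / 5 := by
    rw [hM10, hM11, coe_natMulPt, hτc]
    push_cast
    field_simp
    linear_combination ((σ : ℂ) - 1) * hed
  have hpt : (δ' : ℂ) * ((A • σ : ℍ) : ℂ) = ((M • natMulPt δ hδpos τ : ℍ) : ℂ) := by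
    rw [coe_SL2_smul, coe_SL2_smul, h00, h01, h10, h11, hM00, hM01, hM10, hM11, coe_natMulPt, hτc, hδ']
    push_cast
    have hden' : (e : ℂ) * ((δ : ℂ) * (((σ : ℂ) - 1) / 5)) + 2 = ((9 : ℂ) * σ + 1) / 5 := by
      field_simp
      linear_combination ((σ : ℂ) - 1) * hed
    rw [hden']
    field_simp
    ring
  rw [hpt, eta_SL2_smul_rademacherPhi M (by rw [hM10]; exact_mod_cast hepos) (natMulPt δ hδpos τ), hden,
    rademacherPhiSL_apply, hM00, hM01, hM10, hM11, coe_natMulPt, h9e]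

/-! ## §3 The six divisors -/

section PerDivisor

variable (A : SL(2, ℤ)) (h00 : A 0 0 = 1) (h01 : A 0 1 = 0) (h10 : A 1 0 = 9) (h11 : A 1 1 = 1) (σ : ℍ)
include h00 h01 h10 h11

/-- `η(1·A₀σ) = ζ₂₄⁻⁸ √(9σ+1) η(5τ)` (`Φ(1, 1; 9, 10) = −5`). [cite: AtkinLehner1970, Lemma 7] -/
theorem eta_one_A0 : η ((1 : ℕ) * ((A • σ : ℍ) : ℂ)) = cexp (π * I / 12) ^ (-8 : ℤ) * Complex.sqrt ((9 : ℂ) * σ + 1)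
      * η ((5 : ℕ) * ((affPt 1 (-1) 5 one_pos (by norm_num) σ : ℍ) : ℂ)) := by
  rw [eta_natMul_A0_smul A h00 h01 h10 h11 1 (by norm_num) 5 rfl σ,
    cexp_rademacher_eq_zpow _ (-8) (by rw [rademacherPhi_one_ten _ _ (by norm_num) (by decide)]; norm_num)]

/-- `η(3·A₀σ) = √(9σ+1) η(15τ)` (`Φ(1, 3; 3, 10) = 3`). [cite: AtkinLehner1970, Lemma 7] -/
theorem eta_three_A0 : η ((3 : ℕ) * ((A • σ : ℍ) : ℂ)) = cexp (π * I / 12) ^ (0 : ℤ) * Complex.sqrt ((9 : ℂ) * σ + 1)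
      * η ((15 : ℕ) * ((affPt 1 (-1) 5 one_pos (by norm_num) σ : ℍ) : ℂ)) := by
  rw [eta_natMul_A0_smul A h00 h01 h10 h11 3 (by norm_num) 15 rfl σ,
    cexp_rademacher_eq_zpow _ 0 (by rw [rademacherPhi_one_ten _ _ (by norm_num) (by decide)]; norm_num)]

/-- `η(9·A₀σ) = ζ₂₄⁸ √(9σ+1) η(45τ)` (`Φ(1, 9; 1, 10) = 11`). [cite: AtkinLehner1970, Lemma 7] -/
theorem eta_nine_A0 : η ((9 : ℕ) * ((A • σ : ℍ) : ℂ)) = cexp (π * I / 12) ^ (8 : ℤ) * Complex.sqrt ((9 : ℂ) * σ + 1)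
      * η ((45 : ℕ) * ((affPt 1 (-1) 5 one_pos (by norm_num) σ : ℍ) : ℂ)) := by
  rw [eta_natMul_A0_smul A h00 h01 h10 h11 9 (by norm_num) 45 rfl σ,
    cexp_rademacher_eq_zpow _ 8 (by rw [rademacherPhi_one_ten _ _ (by norm_num) (by decide)]; norm_num)]

/-- `η(5·A₀σ) = ζ₂₄⁻⁴ √((9σ+1)/5) η(τ)` (`Φ(5, 1; 9, 2) = −1`). [cite: AtkinLehner1970, Lemma 7] -/
theorem eta_five_A0 : η ((5 : ℕ) * ((A • σ : ℍ) : ℂ)) = cexp (π * I / 12) ^ (-4 : ℤ) * Complex.sqrt (((9 : ℂ) * σ + 1) / 5)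
      * η ((1 : ℕ) * ((affPt 1 (-1) 5 one_pos (by norm_num) σ : ℍ) : ℂ)) := by
  rw [eta_natMul_A0_smul' A h00 h01 h10 h11 1 (by norm_num) 5 rfl σ,
    cexp_rademacher_eq_zpow _ (-4) (by rw [rademacherPhi_five_two _ _ (by decide)]; norm_num)]

/-- `η(15·A₀σ) = √((9σ+1)/5) η(3τ)` (`Φ(5, 3; 3, 2) = 3`). [cite: AtkinLehner1970, Lemma 7] -/
theorem eta_fifteen_A0 : η ((15 : ℕ) * ((A • σ : ℍ) : ℂ)) = cexp (π * I / 12) ^ (0 : ℤ) * Complex.sqrt (((9 : ℂ) * σ + 1) / 5)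
      * η ((3 : ℕ) * ((affPt 1 (-1) 5 one_pos (by norm_num) σ : ℍ) : ℂ)) := by
  rw [eta_natMul_A0_smul' A h00 h01 h10 h11 3 (by norm_num) 15 rfl σ,
    cexp_rademacher_eq_zpow _ 0 (by rw [rademacherPhi_five_two _ _ (by decide)]; norm_num)]

/-- `η(45·A₀σ) = ζ₂₄⁴ √((9σ+1)/5) η(9τ)` (`Φ(5, 9; 1, 2) = 7`). [cite: AtkinLehner1970, Lemma 7] -/
theorem eta_fortyFive_A0 : η ((45 : ℕ) * ((A • σ : ℍ) : ℂ)) = cexp (π * I / 12) ^ (4 : ℤ) * Complex.sqrt (((9 : ℂ) * σ + 1) / 5)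
      * η ((9 : ℕ) * ((affPt 1 (-1) 5 one_pos (by norm_num) σ : ℍ) : ℂ)) := by
  rw [eta_natMul_A0_smul' A h00 h01 h10 h11 9 (by norm_num) 45 rfl σ,
    cexp_rademacher_eq_zpow _ 4 (by rw [rademacherPhi_five_two _ _ (by decide)]; norm_num)]

/-! ## §4 `T` and `S` are `W₅`-invariant -/

/-- **`T(A₀σ) = T((σ−1)/5)`** for `T = η₁η₅/(η₉η₄₅)` (`x − 2` on `45a1`): `T` is `W₅`-invariant, so the `q`-expansion of `T` at the cusp `1/9 = W₅∞`
(width `5`) is that at `∞` read in `q₅`. [cite: AtkinLehner1970, Lemma 7] -/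
theorem T_A0_smul : etaQuotient 45 (expFn [(1, 1), (5, 1), (9, -1), (45, -1)]) (A • σ)
    = etaQuotient 45 (expFn [(1, 1), (5, 1), (9, -1), (45, -1)]) (affPt 1 (-1) 5 one_pos (by norm_num) σ) := by
  set τ : ℍ := affPt 1 (-1) 5 one_pos (by norm_num) σ with hτ
  have hζ : cexp (π * I / 12) ≠ 0 := Complex.exp_ne_zero _
  have hζ24 : cexp (π * I / 12) ^ (24 : ℕ) = 1 := by
    rw [← Complex.exp_nat_mul, show ((24 : ℕ) : ℂ) * (π * I / 12) = 2 * π * I by push_cast; ring, Complex.exp_two_pi_mul_I]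
  have hj := nine_mul_add_one_ne_zero σ
  have hs : Complex.sqrt ((9 : ℂ) * σ + 1) ≠ 0 := fun h ↦ hj (by rw [← csqrt_sq ((9 : ℂ) * σ + 1), h]; ring)
  have ht : Complex.sqrt (((9 : ℂ) * σ + 1) / 5) ≠ 0 := fun h ↦ hj (by
    have := csqrt_sq (((9 : ℂ) * σ + 1) / 5); rw [h] at this; linear_combination (-5 : ℂ) * this)
  have hη : ∀ d : ℕ, 0 < d → η ((d : ℂ) * (τ : ℂ)) ≠ 0 := fun d hd ↦ eta_natMul_ne_zero hd τ.im_pos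
  have := hη 1 (by norm_num); have := hη 5 (by norm_num); have := hη 9 (by norm_num); have := hη 45 (by norm_num)
  rw [etaQuotient_apply, etaQuotient_apply, show Nat.divisors 45 = {1, 3, 5, 9, 15, 45} by decide]
  repeat rw [Finset.prod_insert (by decide)]
  rw [Finset.prod_singleton, Finset.prod_singleton]
  rw [show expFn [(1, 1), (5, 1), (9, -1), (45, -1)] 1 = 1 by decide,
    show expFn [(1, 1), (5, 1), (9, -1), (45, -1)] 3 = 0 by decide,
    show expFn [(1, 1), (5, 1), (9, -1), (45, -1)] 5 = 1 by decide,
    show expFn [(1, 1), (5, 1), (9, -1), (45, -1)] 9 = (-1) by decide,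
    show expFn [(1, 1), (5, 1), (9, -1), (45, -1)] 15 = 0 by decide,
    show expFn [(1, 1), (5, 1), (9, -1), (45, -1)] 45 = (-1) by decide]
  simp only [zpow_zero, one_mul]
  rw [eta_one_A0 A h00 h01 h10 h11 σ, eta_five_A0 A h00 h01 h10 h11 σ, eta_nine_A0 A h00 h01 h10 h11 σ,
    eta_fortyFive_A0 A h00 h01 h10 h11 σ, ← hτ]
  simp only [zpow_neg, zpow_ofNat, mul_pow, inv_pow]
  field_simp
  rw [hζ24, one_mul]

/-- **`S(A₀σ) = S((σ−1)/5)`** for `S = η₃²η₁₅²/(η₉²η₄₅²)` (`2S − 3T = 2y + x` on `45a1`): `S` is `W₅`-invariant. [cite: AtkinLehner1970, Lemma 7] -/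
theorem S_A0_smul : etaQuotient 45 (expFn [(3, 2), (9, -2), (15, 2), (45, -2)]) (A • σ)
    = etaQuotient 45 (expFn [(3, 2), (9, -2), (15, 2), (45, -2)]) (affPt 1 (-1) 5 one_pos (by norm_num) σ) := by
  set τ : ℍ := affPt 1 (-1) 5 one_pos (by norm_num) σ with hτ
  have hζ : cexp (π * I / 12) ≠ 0 := Complex.exp_ne_zero _
  have hζ24 : cexp (π * I / 12) ^ (24 : ℕ) = 1 := by
    rw [← Complex.exp_nat_mul, show ((24 : ℕ) : ℂ) * (π * I / 12) = 2 * π * I by push_cast; ring, Complex.exp_two_pi_mul_I]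
  have hj := nine_mul_add_one_ne_zero σ
  have hs : Complex.sqrt ((9 : ℂ) * σ + 1) ≠ 0 := fun h ↦ hj (by rw [← csqrt_sq ((9 : ℂ) * σ + 1), h]; ring)
  have ht : Complex.sqrt (((9 : ℂ) * σ + 1) / 5) ≠ 0 := fun h ↦ hj (by
    have := csqrt_sq (((9 : ℂ) * σ + 1) / 5); rw [h] at this; linear_combination (-5 : ℂ) * this)
  have hη : ∀ d : ℕ, 0 < d → η ((d : ℂ) * (τ : ℂ)) ≠ 0 := fun d hd ↦ eta_natMul_ne_zero hd τ.im_pos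
  have := hη 3 (by norm_num); have := hη 15 (by norm_num); have := hη 9 (by norm_num); have := hη 45 (by norm_num)
  rw [etaQuotient_apply, etaQuotient_apply, show Nat.divisors 45 = {1, 3, 5, 9, 15, 45} by decide]
  repeat rw [Finset.prod_insert (by decide)]
  rw [Finset.prod_singleton, Finset.prod_singleton]
  rw [show expFn [(3, 2), (9, -2), (15, 2), (45, -2)] 1 = 0 by decide,
    show expFn [(3, 2), (9, -2), (15, 2), (45, -2)] 3 = 2 by decide,
    show expFn [(3, 2), (9, -2), (15, 2), (45, -2)] 5 = 0 by decide,
    show expFn [(3, 2), (9, -2), (15, 2), (45, -2)] 9 = (-2) by decide,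
    show expFn [(3, 2), (9, -2), (15, 2), (45, -2)] 15 = 2 by decide,
    show expFn [(3, 2), (9, -2), (15, 2), (45, -2)] 45 = (-2) by decide]
  simp only [zpow_zero, one_mul]
  rw [eta_three_A0 A h00 h01 h10 h11 σ, eta_fifteen_A0 A h00 h01 h10 h11 σ, eta_nine_A0 A h00 h01 h10 h11 σ,
    eta_fortyFive_A0 A h00 h01 h10 h11 σ, ← hτ]
  simp only [zpow_neg, zpow_ofNat, mul_pow]
  field_simp
  rw [hζ24, one_mul]

end PerDivisor

end Summit.BirchSwinnertonDyer.BirchSwinnertonDyer.Theorems.ManinLocalTwoThree.AtkinLehnerEtaFortyFive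

end
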